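import Summits.AnomalousDissipation.AnomalousDissipation.Theses.QuarticLadder
import Summits.AnomalousDissipation.AnomalousDissipation.Theses.MomentParity
import Summits.AnomalousDissipation.AnomalousDissipation.Theorems.QuarticGate.Negative.LevelCeiling
import Summits.AnomalousDissipation.AnomalousDissipation.Theorems.QuarticGate.Negative.EnergyRow
import Summits.AnomalousDissipation.AnomalousDissipation.Theorems.QuarticGate.Negative.Laminar
import Summits.AnomalousDissipation.AnomalousDissipation.Theorems.MomentParityQuarticGateSignLemma
import Summits.AnomalousDissipation.AnomalousDissipation.Theorems.MomentParityQuarticGateSurgery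
import Summits.AnomalousDissipation.AnomalousDissipation.Theorems.MomentParityQuarticGateStubOrder3SurgerySym
import Summits.AnomalousDissipation.AnomalousDissipation.Theorems.MomentParityQuarticGateStubOrder2DesignSym
import Summits.AnomalousDissipation.AnomalousDissipation.Theorems.MomentParityQuarticGateStubAxialDefect
import Summits.AnomalousDissipation.AnomalousDissipation.Theorems.MomentParityQuarticGateStubAxialQuadRigidity
import Summits.AnomalousDissipation.AnomalousDissipation.Theorems.MomentParityQuarticGateDefectCone
import Summits.AnomalousDissipation.AnomalousDissipation.Theorems.MomentParityQuarticGateLambdaPositivity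
import Literature.Analysis.FluidPDE.BeltramiWavesCurl

/-!
# Line `dissipative-tower` for crux `QuarticGate` (stmt-AnomalousDissipation-11464)
# — ALTERNATIVE line registered by the crux-strategist (unit cstrat-stmt-AnomalousDissipation-11464-s3)

crux `Summit.AnomalousDissipation.AnomalousDissipation.Theses.QuarticLadder.QuarticGate`
(= `…Theses.MomentParity.QuarticGate` verbatim; shared item stmt-AnomalousDissipation-11464, rank 2 of
route-AnomalousDissipation-QuarticLadder and of route-AnomalousDissipation-MomentParity).

## The line in one paragraph

Keep the whole LANDED order-≤3 tier of the live line `axis-sectors` (S6′ symmetric order-2 design,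
S2q axial quadratic rigidity, S5a axial defect, S5b Casimir-free symmetric order-3 surgery, S4 far-atom
surgery — all sorry-free Theorems, used here BY NAME) and REMOVE the cubic-Casimir classification
(the live line's only open content: `stub_cubicCoreCentre` / `stub_cubicCoreOffCentre` = no axial cubic
Casimir of ball-truncated Galerkin–Euler for every `M ≥ 25`). The surgery never needed "no cubic
Casimir": by the sign lemma the cone of Euler-derivative evaluations `p₃ ↦ {p₃,B_N}(v)` is EXACTLY the
annihilator `Cas₃^⊥` of the cubic Casimirs (card `cubic-transversality`, triage r1 pass), so a defect
certificate for `μ` exists iff `row_μ(C) = 0` for every cubic Casimir `C` (`stub_rowCertificate`).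
For a Casimir the Euler part of the row drops out: `row_μ(C) = ⟨X_f C, M₂⟩ + ν⟨X_Δ C, M₃⟩`, and the
third moment `M₃` is FREE modulo the quadratic rows (positivity is restored by inflating `M₄`: landed
`exists_forall_le_isStrictlyKPositive_shift` takes ANY degree-3 shift) — so all cubic-Casimir rows can
be killed by a second `M₃`-shift (`stub_cubicRowSurgery`) iff no nonzero cubic Casimir `C` has its
viscous derivative `X_Δ C = ⟨Δu, ∇C(u)⟩` equal on `V_N` to the Euler derivative `{Q, B_N}` of a
polynomial `Q` ("no dissipative tower"). THAT STATEMENT IS TRUE AT EVERY LEVEL `N`, with a half-page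
proof by MOMENT AMPLIFICATION (`stub_noDissipativeTower`, the lever of this line): in the frame
coordinates `c ∈ ℝ^A` of the landed sign lemma (`U c = Σ cₐ e_a`, Euler drift `Ẽ` divergence free and
tangent to spheres — PROVED in `MomentParityQuarticGateSignLemma`), with the linear viscous drift
`D c`, `D_{ab} = ⟨Δ e_b, e_a⟩` (`-D ⪰ 4π² Π`, `Π_{ab} = ⟨e_a, e_b⟩` the Gram matrix) and a radial
`C¹` weight `w(c) = φ(|c|²/2)` (`φ ≥ 0`, `φ' ≤ 0`, compact support), three integrations by parts
(`integral_mul_fderiv_eq_neg_fderiv_mul_of_integrable`, as in `…SignLemmaCalculus`):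
(a) `∫ ∇G·Ẽ w = 0` for every `C¹` `G`; (b) `∫ ∇G·Dc w = -tr D ∫G w - ∫ G φ' ⟨Dc,c⟩`;
(c) the same with `Π`. The tower `∇Q̂·Ẽ = ν ∇Ĉ·Dc`, `∇Ĉ·Ẽ = 0` fed into (a) with `G₁ = Ĉ^{2m-1} Q̂`
gives `∫ ∇(Ĉ^{2m})·Dc w = 0`, whence by (b), (c) and Euler's identity for the homogeneous cubic `Ĉ`
(`⟨Πc, ∇Ĉ⟩ = ⟨c, ∇Ĉ⟩ = 3Ĉ`):
`tr(-D) ∫ Ĉ^{2m} w = ∫ Ĉ^{2m} (-φ') ⟨-Dc,c⟩ ≥ 4π² ∫ Ĉ^{2m} (-φ') ⟨Πc,c⟩ = 4π² (6m + tr Π) ∫ Ĉ^{2m} w`;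
for `6m > tr(-D)/4π² - tr Π` this forces `∫ Ĉ^{2m} w = 0`, i.e. `Ĉ = 0` near `0`, i.e. `Ĉ ≡ 0`.
(The m = 1 instance is the INDEFINITE Gibbs identity `E[C·ΛC] = 0` that the card `cubic-transversality`
recorded as insufficient; the even powers `C^{2m}` restore the sign asymptotically in `m`.)

## Stubs (3, all provable-now; no conjectural content) and composition

* `stub_noDissipativeTower` (T, THE LEVER; size M) — all `N`, all `ν ≠ 0`: a homogeneous cubic
  Casimir whose `ν`-viscous derivative is the Euler derivative of some polynomial observable vanishes.
* `stub_cubicRowSurgery` (S7; size M–L, ≈ the landed Kernel → LambdaPositivity → Realize → Assembly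
  back half of S5 with an enlarged linear system, cf. `exists_shifted_sequence_of_casimirRows`) — a
  Slater 3-stationary level-`N` law with finite fourth moments can be re-shifted in `M₃` (and
  re-inflated in `M₄`, re-realised) so that ADDITIONALLY the row of every homogeneous cubic Casimir
  vanishes, keeping level, Slater, 3-stationarity, energy and dissipation; consumes T's conclusion at
  `(N, ν)` as a hypothesis (shape copied verbatim, exactly as S5a consumes S2q).
* `stub_rowCertificate` (S3″; size S–M: `exists_conic_certificate` + `AxialCert.…Functionals` +
  `stub_signLemma`, NO symmetry, NO Casimir hypothesis) — rows of all cubic Casimirs vanish ⟹ plain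
  defect certificate (the shape S4 consumes).
* `QuarticGate_of`: `ν_j := ν₀/(j+2)`; for EVERY `N ≥ max(N₀(ν_j), 2)` (so `∀ᶠ N`, a fortiori `∃ᶠ N`),
  `L := 2N+1`: S6′ → S2q → S5a → S5b → S7(T) → S3″ → S4. Kernel-checked, no sorry of its own;
  concludes `Theses.QuarticLadder.QuarticGate` BY NAME (and `Theses.MomentParity.QuarticGate`, defeq).

Vocabulary: `IsLevel / IsBandTest / polyGrad / IsPolyStationary` of
`Theorems/QuarticGate/Negative/LevelCeiling.lean` (definitional unfoldings of the crux clauses; the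
landed stubs use the same), no local definitions, every stub statement is over existing declarations.

Disproof.lean (cdisprove g2/g3, sections A–K; no `_false_without_` theorem, no Targets) honoured:
(A) level ceiling — witness levels `N ≥ N₀(ν_j) ≍ ν_j^{-1/2}` from S6′ (all large `N`); (B)/(D)/(F)
load-bearing clauses untouched (`ε = 1/2… > 0`, `E = 2`, `ν_j → 0` explicit); (C)/(J) energy and
momentum rows — S6′'s design (landed); §G — the only conjectural content of every registered line was
S2; this line deletes its cubic half outright and keeps the LANDED quadratic half; §H level one inert
(`not_noCubicCasimir_one`): T is NOT an instance — at `N = 1`, `B_1 ≡ 0` makes the tower hypothesis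
read `ν X_Δ C = 0`, and `X_Δ C = -12π² C` on level-one cubics, so T holds there trivially; §I honest
gate `QuarticGateSupported`: NOT reached (far atoms after `N`, as in every surgery line — the crux is
fixed for this seat). Landed `Theorems/QuarticGate/Negative/{LevelCeiling,EnergyRow,Laminar}` are
imported (scratch check = this file); `Negative/DefectCertificateCasimir` (p82008: dropping the Casimir
hypothesis of the OLD S3 is false) is exactly why S3″ carries the Casimir-ROWS hypothesis instead.
-/

namespace Summit.AnomalousDissipation.AnomalousDissipation.Cruxes.QuarticGate.DissipativeTower

open MeasureTheory Filter
open Literature.Analysis.FunctionSpaces Literature.Analysis.FluidPDE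
open Summit.AnomalousDissipation.AnomalousDissipation.Theorems.QuarticGate.Negative
open Summit.AnomalousDissipation.AnomalousDissipation.Theorems

set_option linter.dupNamespace false

/-! ## The stubs -/

/-- **T — NO DISSIPATIVE TOWER over a cubic Casimir (THE LEVER; all levels `N`, all `ν ≠ 0`).**
Let `p(u) = P((u,g₁),…,(u,gₘ))` be a HOMOGENEOUS CUBIC band observable at level `N` that is a Casimir of
level-`N` Galerkin–Euler (`{p,B_N}(u) = nsGeneratorPairing 0 0 u (∇p(u)) = 0` on level-`N` fields), and
suppose its `ν`-viscous derivative `ν⟨Δu, ∇p(u)⟩ = nsGeneratorPairing ν 0 u (∇p(u))` (force `0`; the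
Euler summand vanishes by the Casimir hypothesis) coincides on level-`N` fields with the Euler derivative
`nsGeneratorPairing 0 0 u (∇q(u))` of SOME polynomial band observable `q` (any degree, any test family).
Then `p ≡ 0` on level-`N` fields.
Why true (moment amplification; proof in the file docstring): in frame coordinates (landed
`MomentParityQuarticGateSignLemma`: synthesis `U`, drift `Ẽ` divergence free + tangent to spheres,
chain rule `{p,B_N}(Uc) = ∇p̂·Ẽ`), with the linear drifts `Dc` (`D_{ab} = ⟨Δe_b,e_a⟩`,
`⟨-Dc,c⟩ = ‖∇(Uc)‖² ≥ 4π²‖Uc‖² = 4π²⟨Πc,c⟩`) and `Πc` (Gram matrix), and a compactly supported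
decreasing radial `C¹` weight: `tr(-D)·∫p̂^{2m}w ≥ 4π²(6m + tr Π)·∫p̂^{2m}w` for every `m ≥ 1`
(three integrations by parts `integral_mul_fderiv_eq_neg_fderiv_mul_of_integrable` + Euler's identity
`Σ cₐ∂ₐp̂ = 3p̂`, `MvPolynomial.IsHomogeneous.sum_X_mul_pderiv`), so `∫ p̂^{2m} w = 0` for `m` large and
`p̂ ≡ 0`. Size M (template: `MomentParityQuarticGateSignLemmaCalculus` + `…SignLemma`). [folklore-new:
the `m = 1` case is the classical indefinite Gibbs identity; cf. card `cubic-transversality` §(c)] -/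
theorem stub_noDissipativeTower :
    ∀ (N : ℕ) (ν : ℝ), ν ≠ 0 →
    ∀ (m : ℕ) (g : Fin m → UnitAddTorus (Fin 3) → EuclideanSpace ℝ (Fin 3))
      (P : MvPolynomial (Fin m) ℝ), (∀ i, IsBandTest N (g i)) → P.IsHomogeneous 3 →
      (∀ u : Torus.energySpace (Fin 3), IsLevel N u →
        Torus.nsGeneratorPairing (d := Fin 3) 0 0 u (polyGrad g P u) = 0) →
    ∀ (m' : ℕ) (g' : Fin m' → UnitAddTorus (Fin 3) → EuclideanSpace ℝ (Fin 3))
      (Q : MvPolynomial (Fin m') ℝ), (∀ i, IsBandTest N (g' i)) →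
      (∀ u : Torus.energySpace (Fin 3), IsLevel N u →
        Torus.nsGeneratorPairing (d := Fin 3) 0 0 u (polyGrad g' Q u) =
          Torus.nsGeneratorPairing (d := Fin 3) ν 0 u (polyGrad g P u)) →
    ∀ u : Torus.energySpace (Fin 3), IsLevel N u →
      MvPolynomial.eval (fun j => Torus.pairing u.1 (g j)) P = 0 := by
  sorry

/-- **S7 — CUBIC-ROW SURGERY: a second third-moment shift kills the row of every cubic Casimir.**
Let `μ₁` be a level-`N` probability law with finite fourth moments, SLATER at degree `4`, 3-STATIONARY
for Galerkin NS at `(ν, f, N)` (`f` smooth, `ν ≠ 0`) — the output of the landed S5b — at a level where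
T's conclusion holds (hypothesis, verbatim shape of `stub_noDissipativeTower` at `(N, ν)`). Then there is
a level-`N` probability law `μ₂` with finite fourth moments, Slater at degree `4`, 3-stationary, with the
SAME mean energy and dissipation, such that additionally `∫ row dμ₂ = 0` (integrable) for every
homogeneous cubic band observable that is a Casimir of level-`N` Galerkin–Euler.
Why true: in an orthonormal band basis `b` (`exists_bandBasis`) let `y = (1, M₁, M₂, M₃, M₄)` be the
coordinate moments of `μ₁` (finite: `‖u‖⁴` integrable), `W₃ ⊇ Cas₃` the homogeneous cubics and the cubic
Casimirs (a finite-dimensional subspace: kernel of `P ↦ {p,B_N}` in coordinates, `exists_rowPoly` with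
`ν = 0, f = 0`). For `C ∈ Cas₃`, `row(C) = L_y(R_C)` with `R_C = (X_f C)₂ + ν (X_Δ C)₃` of degree `≤ 3`
(no quartic part). Seek a shift `S` of the degree-3 entries with (i) `⟨(R_Q)₃, S⟩ = 0` for every
homogeneous QUADRATIC basis test `Q` (so all rows of degree-`≤ 2` observables are unchanged: still `0`)
and (ii) `ν⟨(X_Δ Cᵢ)₃, S⟩ = -row(Cᵢ)` on a basis `Cᵢ` of `Cas₃`. By finite-dimensional duality
(`exists_eq_sum_mul_of_forall_sum_eq_zero`, QuadRange) the system is solvable unless a relation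
`Σ p_Q (R_Q)₃ + Σ aᵢ ν (X_Δ Cᵢ)₃ = 0` has `a ≠ 0`, i.e. unless `{q, B_N} = ν X_Δ C` on `V_N` for
`q = ∓Σ p_Q Q` and the Casimir `C = Σ aᵢ Cᵢ ≠ 0` — excluded by the hypothesis (T). Then
`y' = (1, M₁, M₂, M₃ + S, Λ'·M₄)` is strictly positive for `Λ'` large
(`exists_forall_le_isStrictlyKPositive_shift`: `y` is strictly positive in degree 4 by Slater), REALIZE
it (`exists_measure_of_strictlyKPositive`, `exists_level_of_coords`) as `μ₂`; rows of degree `≤ 2` tests,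
energy and dissipation are Riesz functionals of degree-`≤ 3` polynomials whose `S`-pairing vanishes or
of degree-`≤ 2` polynomials (unchanged), and `row_{μ₂}(Cᵢ) = row_{μ₁}(Cᵢ) + ν⟨(X_Δ Cᵢ)₃, S⟩ = 0`.
Size M–L (the landed Kernel/Assembly files of S5, `exists_shifted_sequence_of_casimirRows` /
`order3Surgery_of_casimirRows` as templates). [folklore] -/
theorem stub_cubicRowSurgery :
    ∀ (ν : ℝ) (f : UnitAddTorus (Fin 3) → EuclideanSpace ℝ (Fin 3)) (N : ℕ)
      (μ₁ : Measure (Torus.energySpace (Fin 3))),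
    ν ≠ 0 → Torus.IsSmooth f →
    IsProbabilityMeasure μ₁ → (∀ᵐ u ∂μ₁, IsLevel N u) →
    Integrable (fun u : Torus.energySpace (Fin 3) => ‖u‖ ^ 4) μ₁ →
    (∀ (m : ℕ) (g : Fin m → UnitAddTorus (Fin 3) → EuclideanSpace ℝ (Fin 3))
      (P : MvPolynomial (Fin m) ℝ), (∀ i, IsBandTest N (g i)) → P.totalDegree ≤ 4 →
      (∀ u : Torus.energySpace (Fin 3), IsLevel N u →
        0 ≤ MvPolynomial.eval (fun j => Torus.pairing u.1 (g j)) P) →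
      (∃ u : Torus.energySpace (Fin 3), IsLevel N u ∧
        MvPolynomial.eval (fun j => Torus.pairing u.1 (g j)) P ≠ 0) →
      0 < ∫ u, MvPolynomial.eval (fun j => Torus.pairing u.1 (g j)) P ∂μ₁) →
    IsPolyStationary ν f N 3 μ₁ →
    (∀ (m : ℕ) (g : Fin m → UnitAddTorus (Fin 3) → EuclideanSpace ℝ (Fin 3))
      (P : MvPolynomial (Fin m) ℝ), (∀ i, IsBandTest N (g i)) → P.IsHomogeneous 3 →
      (∀ u : Torus.energySpace (Fin 3), IsLevel N u →
        Torus.nsGeneratorPairing (d := Fin 3) 0 0 u (polyGrad g P u) = 0) →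
      ∀ (m' : ℕ) (g' : Fin m' → UnitAddTorus (Fin 3) → EuclideanSpace ℝ (Fin 3))
        (Q : MvPolynomial (Fin m') ℝ), (∀ i, IsBandTest N (g' i)) →
        (∀ u : Torus.energySpace (Fin 3), IsLevel N u →
          Torus.nsGeneratorPairing (d := Fin 3) 0 0 u (polyGrad g' Q u) =
            Torus.nsGeneratorPairing (d := Fin 3) ν 0 u (polyGrad g P u)) →
      ∀ u : Torus.energySpace (Fin 3), IsLevel N u →
        MvPolynomial.eval (fun j => Torus.pairing u.1 (g j)) P = 0) →
    ∃ μ₂ : Measure (Torus.energySpace (Fin 3)), IsProbabilityMeasure μ₂ ∧ (∀ᵐ u ∂μ₂, IsLevel N u) ∧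
      Integrable (fun u : Torus.energySpace (Fin 3) => ‖u‖ ^ 4) μ₂ ∧
      (∀ (m : ℕ) (g : Fin m → UnitAddTorus (Fin 3) → EuclideanSpace ℝ (Fin 3))
        (P : MvPolynomial (Fin m) ℝ), (∀ i, IsBandTest N (g i)) → P.totalDegree ≤ 4 →
        (∀ u : Torus.energySpace (Fin 3), IsLevel N u →
          0 ≤ MvPolynomial.eval (fun j => Torus.pairing u.1 (g j)) P) →
        (∃ u : Torus.energySpace (Fin 3), IsLevel N u ∧
          MvPolynomial.eval (fun j => Torus.pairing u.1 (g j)) P ≠ 0) →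
        0 < ∫ u, MvPolynomial.eval (fun j => Torus.pairing u.1 (g j)) P ∂μ₂) ∧
      IsPolyStationary ν f N 3 μ₂ ∧
      (∀ (m : ℕ) (g : Fin m → UnitAddTorus (Fin 3) → EuclideanSpace ℝ (Fin 3))
        (P : MvPolynomial (Fin m) ℝ), (∀ i, IsBandTest N (g i)) → P.IsHomogeneous 3 →
        (∀ u : Torus.energySpace (Fin 3), IsLevel N u →
          Torus.nsGeneratorPairing (d := Fin 3) 0 0 u (polyGrad g P u) = 0) →
        Integrable (fun u : Torus.energySpace (Fin 3) =>
          Torus.nsGeneratorPairing ν f u (polyGrad g P u)) μ₂ ∧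
        ∫ u, Torus.nsGeneratorPairing ν f u (polyGrad g P u) ∂μ₂ = 0) ∧
      Torus.ensembleEnergy μ₂ = Torus.ensembleEnergy μ₁ ∧
      Torus.ensembleDissipation ν μ₂ = Torus.ensembleDissipation ν μ₁ := by
  sorry

/-- **S3″ — DEFECT CERTIFICATE FROM VANISHING CASIMIR ROWS (no symmetry, no Casimir hypothesis).**
For a smooth force `f`, a level-`N` probability law `μ` with finite fourth moments whose row
`∫ nsGeneratorPairing ν f u (∇p(u)) dμ` vanishes on every homogeneous cubic band observable `p` that is
a Casimir of level-`N` Galerkin–Euler, there are finitely many level-`N` fields `vₗ` and weights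
`cₗ ≥ 0` with `row_μ(p₃) + Σₗ cₗ {p₃,B_N}(vₗ) = 0` for EVERY homogeneous cubic band test `p₃` — the
plain certificate shape consumed by the landed surgery S4 (`MomentParityQuarticGate.stub_surgery`).
Why true: transport every cubic band test to an orthonormal band basis (`exists_bandBasis`,
`polyGrad_transport`), `W :=` homogeneous cubics in `n` variables; the row `ψ` and the Euler-derivative
evaluations `ev_v` are linear functionals on `W` (`AxialCert.integrable_and_exists_cubicRowFunctional`,
`AxialCert.exists_pointRowFunctional`, landed); apply the landed abstract cone lemma
`exists_conic_certificate` to `(ev, ψ)`: its hypothesis "`ev_v P ≥ 0 ∀ v ⟹ ψ P = 0 ∧ ev_v P = 0 ∀ v`"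
holds because `{p,B_N} ≥ 0` on `V_N` forces `{p,B_N} ≡ 0` (sign lemma `stub_signLemma`, S1 LANDED),
i.e. `p` is a cubic Casimir, on which `ψ` vanishes BY HYPOTHESIS. (Equivalently: `cone{ev_v}` is the
whole annihilator `Cas₃^⊥`.) Size S–M. Not an instance of `Negative/DefectCertificateCasimir`
(p82008), which drops the Casimir information altogether. [folklore] -/
theorem stub_rowCertificate :
    ∀ (N : ℕ) (ν : ℝ) (f : UnitAddTorus (Fin 3) → EuclideanSpace ℝ (Fin 3)), Torus.IsSmooth f →
    ∀ μ : Measure (Torus.energySpace (Fin 3)), IsProbabilityMeasure μ → (∀ᵐ u ∂μ, IsLevel N u) →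
    Integrable (fun u : Torus.energySpace (Fin 3) => ‖u‖ ^ 4) μ →
    (∀ (m : ℕ) (g : Fin m → UnitAddTorus (Fin 3) → EuclideanSpace ℝ (Fin 3))
      (P : MvPolynomial (Fin m) ℝ), (∀ i, IsBandTest N (g i)) → P.IsHomogeneous 3 →
      (∀ u : Torus.energySpace (Fin 3), IsLevel N u →
        Torus.nsGeneratorPairing (d := Fin 3) 0 0 u (polyGrad g P u) = 0) →
      ∫ u, Torus.nsGeneratorPairing ν f u (polyGrad g P u) ∂μ = 0) →
    ∃ (M : ℕ) (v : Fin M → Torus.energySpace (Fin 3)) (c : Fin M → ℝ),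
      (∀ l, IsLevel N (v l)) ∧ (∀ l, 0 ≤ c l) ∧
      ∀ (m : ℕ) (g : Fin m → UnitAddTorus (Fin 3) → EuclideanSpace ℝ (Fin 3))
        (P : MvPolynomial (Fin m) ℝ), (∀ i, IsBandTest N (g i)) → P.IsHomogeneous 3 →
        ∫ u, Torus.nsGeneratorPairing ν f u (polyGrad g P u) ∂μ +
          ∑ l, c l * Torus.nsGeneratorPairing (d := Fin 3) 0 0 (v l) (polyGrad g P (v l)) = 0 := by
  sorry

/-! ## The composition (kernel-checked, no `sorry` of its own) -/

/-- **`QuarticGate` from the three stubs and the landed order-≤3 tier.** Take `f, E, ε, ν₀` from the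
landed symmetric order-2 design S6′ and `ν_j := ν₀/(j+2)` (positive, `< ν₀`, `→ 0`). At each `j`, S6′
gives `N₀`; for EVERY `N ≥ max(N₀, 2)` (eventually, hence frequently, in `N`), with `L := 2N + 1`:
S6′ gives the symmetric loud order-2 design `μ₀`; S2q + S5a (landed) kill every quadratic Casimir row;
S5b (landed) gives a Slater 3-stationary `μ₁` with the same energy/dissipation; S7 (fed T at `(N, ν_j)`)
re-shifts it to `μ₂` with all cubic-Casimir rows zero; S3″ turns that into a plain defect certificate;
S4 (landed) performs the far-atom surgery: a level-`N` 4-stationary law with energy `≤ E` and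
dissipation `≥ ε`. -/
theorem QuarticGate_of :
    Summit.AnomalousDissipation.AnomalousDissipation.Theses.QuarticLadder.QuarticGate := by
  obtain ⟨f, hfs, hfd, hfz, hfsym, E, ε, ν₀, hε, hν₀, hK1⟩ :=
    MomentParityQuarticGate.stub_order2DesignSym
  have hνpos : ∀ j : ℕ, 0 < ν₀ / ((j : ℝ) + 2) := fun j => div_pos hν₀ (by positivity)
  have hνlt : ∀ j : ℕ, ν₀ / ((j : ℝ) + 2) < ν₀ := fun j => by
    rw [div_lt_iff₀ (by positivity)]
    nlinarith [(Nat.cast_nonneg j : (0 : ℝ) ≤ j)]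
  have hνlim : Tendsto (fun j : ℕ => ν₀ / ((j : ℝ) + 2)) atTop (nhds 0) :=
    tendsto_const_nhds.div_atTop
      (tendsto_atTop_add_const_right atTop (2 : ℝ) tendsto_natCast_atTop_atTop)
  refine ⟨f, hfs, hfd, hfz, fun j => ν₀ / ((j : ℝ) + 2), E, ε, hνpos, hνlim, hε, fun j => ?_⟩
  obtain ⟨N₀, hN₀⟩ := hK1 _ (hνpos j) (hνlt j)
  refine Filter.Eventually.frequently ?_
  filter_upwards [eventually_ge_atTop N₀, eventually_ge_atTop 2] with N hN h2
  obtain ⟨μ₀, hp₀, hl₀, hR₀, hnd₀, hsym₀, hlin₀, hErow₀, hHrow₀, hE₀, hD₀⟩ :=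
    hN₀ N hN (2 * N + 1) (Nat.succ_pos _)
  have hQuad := MomentParityQuarticGate.stub_axialQuadRigidity N h2 (2 * N + 1) (by omega)
  have hCas := MomentParityQuarticGate.stub_axialDefect _ f N (2 * N + 1) μ₀ hfs hfsym (by omega)
    hp₀ hl₀ hR₀ hsym₀ hErow₀ hHrow₀ hQuad
  obtain ⟨μ₁, hp₁, hl₁, hi₁, hsl₁, hst₁, -, hE₁, hD₁⟩ :=
    MomentParityQuarticGate.stub_order3SurgerySym _ f N (2 * N + 1) μ₀ hfs hfsym (Nat.succ_pos _)
      hp₀ hl₀ hR₀ hnd₀ hsym₀ hlin₀ (fun m g P hg hP hC => (hCas m g P hg hP hC).2)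
  have hT := stub_noDissipativeTower N (ν₀ / ((j : ℝ) + 2)) (hνpos j).ne'
  obtain ⟨μ₂, hp₂, hl₂, hi₂, hsl₂, hst₂, hrow₂, hE₂, hD₂⟩ :=
    stub_cubicRowSurgery _ f N μ₁ (hνpos j).ne' hfs hp₁ hl₁ hi₁ hsl₁ hst₁ hT
  obtain ⟨M, v, c, hcert⟩ :=
    stub_rowCertificate N _ f hfs μ₂ hp₂ hl₂ hi₂ (fun m g P hg hP hC => (hrow₂ m g P hg hP hC).2)
  obtain ⟨μ, hp, hl, hi, hst, hE, hD⟩ :=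
    MomentParityQuarticGate.stub_surgery _ f N μ₂ hfs hp₂ hl₂ hi₂ hsl₂ hst₂ M v c hcert
  refine ⟨μ, hp, hl, hi, hst, ?_, ?_⟩
  · rw [hE, hE₂, hE₁]; exact hE₀
  · rw [hD, hD₂, hD₁]; exact hD₀

/-- The same theorem under the `MomentParity` name of the shared crux (the two route decls are
verbatim copies; definitional unfolding). -/
theorem QuarticGate_of_momentParity :
    Summit.AnomalousDissipation.AnomalousDissipation.Theses.MomentParity.QuarticGate :=
  QuarticGate_of

end Summit.AnomalousDissipation.AnomalousDissipation.Cruxes.QuarticGate.DissipativeTower
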